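import Literature.Topology.FourManifolds.IntersectionLatticeOrientationProofs
import Literature.Topology.FourManifolds.SmoothOrientationProofs
import Literature.AlgebraicTopology.SingularHomology.ChartTransitionLocalDegree
import Literature.AlgebraicTopology.SingularHomology.OrientationCover
import HarnessLib

/-!
# Proofs for `IntersectionLattice`: `ℤ`-orientable Hausdorff manifolds are smoothly orientable

Sibling proof file of `Literature.Topology.FourManifolds.IntersectionLattice`, complementing
`IntersectionLatticeOrientationProofs.lean` (which DISCHARGES
`isOrientableOver_int_of_isOrientable`: smoothly orientable ⇒ `ℤ`-orientable, for every `C¹`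
manifold charted on `𝔼 n = EuclideanSpace ℝ (Fin n)`). Here we prove the **converse for
Hausdorff manifolds** and hence the equivalence
`isOrientable_iff_isOrientableOver_int_of_t2Space` (G. Bredon, *Topology and Geometry* (1993),
VI.7, Prop. 7.14–Thm. 7.15; J. Milnor, J. Stasheff, *Characteristic Classes* (1974), Appendix A;
A. Hatcher, *Algebraic Topology* (2002), §3.3 pp. 233–236).

## On the statement of `isOrientable_iff_isOrientableOver_int`

The named fact `Literature.Topology.FourManifolds.isOrientable_iff_isOrientableOver_int` was
written in a section with `variable [T2Space X] [SecondCountableTopology X]`, but Lean keeps in a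
`def` only the section variables its body uses, so the fact as declared reads
`(X : Type u) [TopologicalSpace X] {n : ℕ} [ChartedSpace (𝔼 n) X] [IsManifold (𝓡 n) 1 X] :
IsOrientable (𝓡 n) X ↔ IsOrientableOver ℤ X n` — **without the Hausdorff hypothesis**. In that
generality the implication `←` is false: for the Möbius band with its core circle doubled (two
copies of the open Möbius band glued along the complement of the core, a non-Hausdorff `C^∞`
surface) the homological local classes may change sign across a doubled point (on the line with
two origins `L`, `H₁(L | (-ε, ε) ∪ {0₁})` contains the class of the segment from `ε` to the
*other* origin, which restricts to a generator on `(0, ε)` and to `0` on `(-ε, 0]`), so a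
`Literature.AlgebraicTopology.SingularHomology.HomologicalOrientation` exists although no smooth
orientation does. The sources (Bredon, Milnor–Stasheff, Hatcher) assume manifolds Hausdorff. We
therefore prove the corrected statement `isOrientable_iff_isOrientableOver_int_of_t2Space`
(same content, `[T2Space X]` added; second countability is not needed) as a theorem.

## The proof of the converse

Fix a `ℤ`-orientation `g` of `𝔼 n` (`isOrientableOver_int_of_simplyConnectedSpace_holds`). The
*reference class* at `x` is `R_x = (chartXEquiv (chartAt x)).symm (g (chartAt x x)) ∈ Hₙ(X | x)`
(`…SingularHomology.LocalHomologyUniverse`, across universes). By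
`…SingularHomology.ChartTransitionLocalDegree` (building on the local degree of linear maps,
Hatcher §2.2 Ex. 7, `…LinearLocalDegree`, the linearization `…LocalDegreeLinearization`, and —
essential for this direction — the degree `-1` of a reflection, `…ReflectionLocalDegree`):
(1) for `y` near `x` the reference class of `chartAt y` at `y` equals `±` that of `chartAt x`
at `y`, with `+` iff the chart change `tangentCoordChange (𝓡 n) y x y` has positive determinant
— the very condition in `Literature.Topology.FourManifolds.SmoothOrientation`; (2) on a
Hausdorff `X`, agreement of a `ℤ`-orientation `μ` with the reference classes of a fixed chart is
locally constant. Then `o x = ± ε₀` (sign: `μ_x = R_x`) is a smooth orientation. Everything is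
proved; no definitions and no named facts are introduced.

The last section records that the neighbouring fact
`nonempty_homologicalOrientation_int_of_simplyConnectedSpace` suffered the same loss of binders
(it quantifies over all simply connected spaces) and refutes it as declared with the one-point
space (`not_nonempty_homologicalOrientation_int_of_simplyConnectedSpace_punit`); its intended
content is the tree's proved `isOrientableOver_int_of_simplyConnectedSpace_holds`.

## References

* G. E. Bredon, *Topology and Geometry*, GTM 139, Springer 1993, VI.7. [Bredon1993]
* J. Milnor, J. Stasheff, *Characteristic Classes*, Princeton 1974, Appendix A.
  [MilnorStasheff1974]
* A. Hatcher, *Algebraic Topology*, CUP 2002, §3.3 pp. 233–236. [HatcherAT2002]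
-/

noncomputable section

open scoped Manifold ContDiff Topology
open Set Filter
open Literature.AlgebraicTopology.SingularHomology

universe u

namespace Literature.Topology.FourManifolds

/-! ### Two-valued sign bookkeeping -/

section Logic

variable {α : Type*} [Neg α]

/-- `(if P then a else -a) = (if Q then a else -a) ↔ (P ↔ Q)` when `a ≠ -a`. [folklore] -/
theorem ite_neg_eq_ite_neg_iff {a : α} (ha : -a ≠ a) (P Q : Prop) [Decidable P] [Decidable Q] :
    ((if P then a else -a) = if Q then a else -a) ↔ (P ↔ Q) := by
  by_cases hP : P <;> by_cases hQ : Q <;> simp [hP, hQ, ha, ha.symm]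

end Logic

/-! ### The chart change of a `C¹` manifold charted on `𝔼 n` -/

section Transition

variable {X : Type u} [TopologicalSpace X] {n : ℕ} [ChartedSpace (EuclideanSpace ℝ (Fin n)) X]
  [IsManifold (𝓡 n) 1 X]

/-- The transition map `chartAt x ∘ (chartAt y)⁻¹` of a `C¹` manifold charted on `𝔼 n` is
differentiable at `chartAt y y` with derivative `tangentCoordChange (𝓡 n) y x y`, for `y` in the
domain of `chartAt x` (Mathlib's `hasFDerivWithinAt_tangentCoordChange`; the model `𝓡 n` is
boundaryless and its extended charts are the charts). [folklore] -/
theorem hasFDerivAt_chartAt_comp_symm (x y : X)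
    (hy : y ∈ (chartAt (EuclideanSpace ℝ (Fin n)) x).source) :
    HasFDerivAt (fun v => chartAt (EuclideanSpace ℝ (Fin n)) x
        ((chartAt (EuclideanSpace ℝ (Fin n)) y).symm v))
      (tangentCoordChange (𝓡 n) y x y) (chartAt (EuclideanSpace ℝ (Fin n)) y y) := by
  have h : y ∈ (extChartAt (𝓡 n) y).source ∩ (extChartAt (𝓡 n) x).source := by
    simp only [extChartAt_source]
    exact ⟨mem_chart_source _ y, hy⟩
  have := hasFDerivWithinAt_tangentCoordChange (I := 𝓡 n) h
  rw [ModelWithCorners.range_eq_univ, hasFDerivWithinAt_univ] at this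
  exact this

/-- The chart change has nonvanishing Jacobian determinant (the tree's
`det_tangentCoordChange_ne_zero`). [folklore] -/
theorem det_tangentCoordChange_chartAt_ne_zero (x y : X)
    (hy : y ∈ (chartAt (EuclideanSpace ℝ (Fin n)) x).source) :
    LinearMap.det ((tangentCoordChange (𝓡 n) y x y :
      EuclideanSpace ℝ (Fin n) →L[ℝ] EuclideanSpace ℝ (Fin n)) :
        EuclideanSpace ℝ (Fin n) →ₗ[ℝ] EuclideanSpace ℝ (Fin n)) ≠ 0 := by
  have h : y ∈ (extChartAt (𝓡 n) y).source ∩ (extChartAt (𝓡 n) x).source := by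
    simp only [extChartAt_source]
    exact ⟨mem_chart_source _ y, hy⟩
  exact det_tangentCoordChange_ne_zero h

/-- **Change of chart acts on the reference classes by the sign of the Jacobian of the chart
change**: for `y ∈ (chartAt x).source`, the reference class of `chartAt y` at `y` equals that of
`chartAt x` at `y` if `det (tangentCoordChange (𝓡 n) y x y) > 0`, and its negative otherwise
(Bredon 1993, VI.7, Prop. 7.14; `chartXEquiv_symm_localClass_eq_of_hasFDerivAt`).
[cite: Bredon1993, VI.7] -/
theorem chartXEquiv_symm_chartAt_eq [T1Space X]
    (g : HomologicalOrientation ℤ (EuclideanSpace ℝ (Fin n)) n) (x y : X)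
    (hy : y ∈ (chartAt (EuclideanSpace ℝ (Fin n)) x).source) :
    (localHomology.chartXEquiv ℤ ℤ (chartAt (EuclideanSpace ℝ (Fin n)) y)
        (mem_chart_source _ y) n).symm
        (g.localClass (chartAt (EuclideanSpace ℝ (Fin n)) y y)) =
      if 0 < LinearMap.det ((tangentCoordChange (𝓡 n) y x y :
          EuclideanSpace ℝ (Fin n) →L[ℝ] EuclideanSpace ℝ (Fin n)) :
            EuclideanSpace ℝ (Fin n) →ₗ[ℝ] EuclideanSpace ℝ (Fin n))
      then (localHomology.chartXEquiv ℤ ℤ (chartAt (EuclideanSpace ℝ (Fin n)) x) hy n).symm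
        (g.localClass (chartAt (EuclideanSpace ℝ (Fin n)) x y))
      else -(localHomology.chartXEquiv ℤ ℤ (chartAt (EuclideanSpace ℝ (Fin n)) x) hy n).symm
        (g.localClass (chartAt (EuclideanSpace ℝ (Fin n)) x y)) :=
  chartXEquiv_symm_localClass_eq_of_hasFDerivAt g (chartAt _ x) (chartAt _ y) hy
    (mem_chart_source _ y) (hasFDerivAt_chartAt_comp_symm x y hy)
    (det_tangentCoordChange_chartAt_ne_zero x y hy)

end Transition

/-! ### Hausdorff `ℤ`-orientable manifolds are smoothly orientable -/

section Bridge

variable (X : Type u) [TopologicalSpace X] {n : ℕ} [ChartedSpace (EuclideanSpace ℝ (Fin n)) X]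
  [IsManifold (𝓡 n) 1 X]

/-- **A homological `ℤ`-orientation of a Hausdorff `C¹` manifold determines a smooth
orientation** (Bredon 1993, VI.7, Thm. 7.15; Milnor–Stasheff 1974, App. A): `o x = ± ε₀`
(`ε₀ = euclideanOrientation n`) with sign `+` iff `μ_x` is the reference class `R_x` of
`chartAt x`. The axiom of `SmoothOrientation` at `x` follows since, for `y` near `x`, agreement
`μ_y = (reference class of chartAt x at y)` is equivalent to agreement at `x`
(`HomologicalOrientation.eventually_localClass_eq_chartXEquiv_symm_iff`, which uses that `X`
is Hausdorff) while the reference class of `chartAt y` at `y` is that of `chartAt x` exactly when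
the chart change has positive Jacobian (`chartXEquiv_symm_chartAt_eq`).
[cite: Bredon1993, VI.7 Thm. 7.15] -/
theorem nonempty_smoothOrientation_of_homologicalOrientation [T2Space X]
    (g : HomologicalOrientation ℤ (EuclideanSpace ℝ (Fin n)) n) (μ : HomologicalOrientation ℤ X n) :
    Nonempty (SmoothOrientation (𝓡 n) X) := by
  classical
  have hε : -euclideanOrientation n ≠ euclideanOrientation n :=
    (Module.Ray.ne_neg_self (euclideanOrientation n)).symm
  let F : X → Orientation ℝ (EuclideanSpace ℝ (Fin n))
      (Fin (Module.finrank ℝ (EuclideanSpace ℝ (Fin n)))) := fun x =>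
    if μ.localClass x =
        (localHomology.chartXEquiv ℤ ℤ (chartAt (EuclideanSpace ℝ (Fin n)) x)
          (mem_chart_source _ x) n).symm
          (g.localClass (chartAt (EuclideanSpace ℝ (Fin n)) x x))
    then euclideanOrientation n else -euclideanOrientation n
  have hF : ∀ x, F x = if μ.localClass x =
        (localHomology.chartXEquiv ℤ ℤ (chartAt (EuclideanSpace ℝ (Fin n)) x)
          (mem_chart_source _ x) n).symm
          (g.localClass (chartAt (EuclideanSpace ℝ (Fin n)) x x))
    then euclideanOrientation n else -euclideanOrientation n := fun x => rfl
  refine ⟨{ toFun := F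
            eventually_eq_iff' := fun x => ?_ }⟩
  have hev := μ.eventually_localClass_eq_chartXEquiv_symm_iff g
    (chartAt (EuclideanSpace ℝ (Fin n)) x) (mem_chart_source _ x)
  filter_upwards [hev] with y hy'
  obtain ⟨hyc, hiff⟩ := hy'
  rw [hF y, hF x, ite_neg_eq_ite_neg_iff hε]
  have hchg := chartXEquiv_symm_chartAt_eq g x y hyc
  by_cases hD : 0 < LinearMap.det ((tangentCoordChange (𝓡 n) y x y :
      EuclideanSpace ℝ (Fin n) →L[ℝ] EuclideanSpace ℝ (Fin n)) :
        EuclideanSpace ℝ (Fin n) →ₗ[ℝ] EuclideanSpace ℝ (Fin n))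
  · rw [hchg, if_pos hD]
    exact iff_of_true hiff hD
  · rw [hchg, if_neg hD]
    refine iff_of_false (fun habs => ?_) hD
    have hgen := isGenerator_chartXEquiv_symm_localClass g
      (chartAt (EuclideanSpace ℝ (Fin n)) x) hyc
    have h1 : (μ.localClass y =
        -(localHomology.chartXEquiv ℤ ℤ (chartAt (EuclideanSpace ℝ (Fin n)) x) hyc n).symm
          (g.localClass (chartAt (EuclideanSpace ℝ (Fin n)) x y))) ↔
        ¬ μ.localClass y =
          (localHomology.chartXEquiv ℤ ℤ (chartAt (EuclideanSpace ℝ (Fin n)) x) hyc n).symm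
            (g.localClass (chartAt (EuclideanSpace ℝ (Fin n)) x y)) :=
      ⟨fun h e => neg_ne_self_of_isGenerator hgen (h.symm.trans e),
        fun hne => (eq_or_eq_neg_of_isGenerator (μ.isGenerator y) hgen).resolve_left hne⟩
    exact iff_not_self (hiff.trans (habs.symm.trans h1))

/-- **A Hausdorff `ℤ`-orientable `C¹` manifold is smoothly orientable** (Bredon 1993, VI.7,
Thm. 7.15; Milnor–Stasheff 1974, Appendix A). [cite: Bredon1993, VI.7 Thm. 7.15] -/
theorem isOrientable_of_isOrientableOver_int [T2Space X] (h : IsOrientableOver ℤ X n) :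
    IsOrientable (𝓡 n) X := by
  obtain ⟨μ⟩ := h
  obtain ⟨g⟩ := (isOrientableOver_int_of_simplyConnectedSpace_holds (EuclideanSpace ℝ (Fin n)) :
    IsOrientableOver ℤ (EuclideanSpace ℝ (Fin n)) n)
  exact nonempty_smoothOrientation_of_homologicalOrientation X g μ

/-- **Smooth orientability is equivalent to homological `ℤ`-orientability for Hausdorff `C¹`
manifolds** (Bredon 1993, VI.7, Prop. 7.14–Thm. 7.15; Milnor–Stasheff 1974, Appendix A;
Hatcher 2002, §3.3). This is the CORRECTED form of the named fact
`Literature.Topology.FourManifolds.isOrientable_iff_isOrientableOver_int` of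
`IntersectionLattice.lean`: that `def` lost the intended binder `[T2Space X]` (Lean drops unused
section variables from a definition), and without it the implication `←` fails for
non-Hausdorff manifolds (e.g. the Möbius band with doubled core circle, see the module
docstring); the sources assume Hausdorff manifolds, which is the statement proved here (second
countability, also intended there, is not needed). [cite: MilnorStasheff1974, Appendix A] -/
theorem isOrientable_iff_isOrientableOver_int_of_t2Space [T2Space X] :
    IsOrientable (𝓡 n) X ↔ IsOrientableOver ℤ X n :=
  ⟨fun h => isOrientableOver_int_of_isOrientable_holds X h,
    fun h => isOrientable_of_isOrientableOver_int X h⟩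

end Bridge

/-! ### The fact `nonempty_homologicalOrientation_int_of_simplyConnectedSpace` is mis-stated -/

section Refutation

/-- **`nonempty_homologicalOrientation_int_of_simplyConnectedSpace` is false as declared.** Like
its neighbour `isOrientable_iff_isOrientableOver_int`, the named fact
`Literature.Topology.FourManifolds.nonempty_homologicalOrientation_int_of_simplyConnectedSpace`
of `IntersectionLattice.lean` lost its intended instance binders: the declared statement is
`(X : Type u) [TopologicalSpace X] {n : ℕ} : ∀ [SimplyConnectedSpace X], Nonempty
(HomologicalOrientation ℤ X n)` — for EVERY simply connected space and every `n`, with neither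
`[ChartedSpace (𝔼 n) X]` nor `[T2Space X]`. The one-point space refutes it for `n = 1`:
`H₁(pt | pt; ℤ) = H₁(pt, ∅; ℤ) ≅ H₁(pt; ℤ) = 0` has no generator. The intended statement (a
simply connected topological `n`-manifold is `ℤ`-orientable, Hatcher 2002, §3.3, Prop. 3.25) is
the tree's PROVED `isOrientableOver_int_of_simplyConnectedSpace_holds` (`…OrientationCover`,
for `X : Type`). [cite: HatcherAT2002, §3.3 Prop. 3.25] -/
theorem not_nonempty_homologicalOrientation_int_of_simplyConnectedSpace_punit :
    ¬ nonempty_homologicalOrientation_int_of_simplyConnectedSpace (n := 1) PUnit.{u + 1} := by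
  intro h
  obtain ⟨μ⟩ := @h inferInstance
  obtain ⟨e, he⟩ := μ.isGenerator PUnit.unit
  haveI : IsEmpty (({PUnit.unit}ᶜ : Set PUnit.{u + 1}) : Type u) :=
    ⟨fun x => x.2 (Subsingleton.elim _ _)⟩
  haveI := relativeSingularHomology.isIso_ofAbsolute_of_isEmpty ℤ ℤ (X := PUnit.{u + 1})
    ({PUnit.unit}ᶜ : Set PUnit.{u + 1}) 1
  have hZ : CategoryTheory.Limits.IsZero (localHomology ℤ ℤ PUnit.{u + 1} PUnit.unit 1) :=
    (isZero_singularHomology_of_subsingleton ℤ ℤ (X := PUnit.{u + 1}) one_ne_zero).of_iso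
      (CategoryTheory.asIso (relativeSingularHomology.ofAbsolute ℤ ℤ PUnit.{u + 1}
        ({PUnit.unit}ᶜ : Set PUnit.{u + 1}) 1)).symm
  haveI := ModuleCat.subsingleton_of_isZero hZ
  have h0 : μ.localClass PUnit.unit = 0 := Subsingleton.elim _ _
  rw [h0, map_zero] at he
  exact zero_ne_one he

end Refutation

end Literature.Topology.FourManifolds
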